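import Mathlib.Analysis.Complex.ExponentialBounds
import Literature.NumberTheory.LFunctions.DeBruijnPhiComplex
import HarnessLib

/-!
# The complex Pólya–de Bruijn kernel `Φ_C`: dominance of the first theta term in the strip `|Im u| < π/8`

Topic `Literature/NumberTheory/LFunctions`; sequel of `DeBruijnPhiComplex.lean` (`deBruijnPhiC`, holomorphy on the strip,
the TOTAL strip majorant `norm_deBruijnPhiC_le`). For the steepest-descent treatment of `Φ`-weighted integrals on a shifted
horizontal contour (route `rh-jensen`, crux `XiWindowZeroFreeRelFar`: the contour `Im u = y_s`, `|y_s| ≤ 0.09`, through the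
saddle) one needs more than the size of `Φ_C`: the phase `log Φ_C` must be explicit, i.e. the FIRST TERM
`a₁(u) = (2π²e^{9u} − 3πe^{5u})e^{−πe^{4u}} = eᵘ(2Y² − 3Y)e^{−Y}` (`Y = πe^{4u} ∈ ℂ`) must dominate, with an explicit
relative error, and `Φ_C` must not vanish there. With `x = Re u`, `y = Im u`, `Y_c := πe^{4x}cos 4y = Re Y > 0` we prove:

* `deBruijnPhiStripMajorant_succ_le`, `tsum_deBruijnPhiStripMajorant_succ_le`: the `n ≥ 2` terms of the strip majorant are
  dominated geometrically: `∑_{n≥1} majorant(x, y, n) ≤ 32(2π²e^{9x} + 3πe^{5x})e^{−4Y_c}` once `16e^{−4Y_c} ≤ 1/2`;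
* `norm_deBruijnPhiC_sub_head_le`: `‖Φ_C(u) − a₁(u)‖ ≤ 32(2π²e^{9x} + 3πe^{5x})e^{−4Y_c}`;
* `le_norm_deBruijnPhiSummandC_zero`: `‖a₁(u)‖ ≥ (2π²e^{9x} − 3πe^{5x})e^{−Y_c}`;
* `norm_deBruijnPhiC_sub_head_le_mul_norm_head`: for `x ≥ 0` and `Y_c ≥ 2`,
  `‖Φ_C(u) − a₁(u)‖ ≤ 92e^{−3Y_c}·‖a₁(u)‖`, hence `deBruijnPhiC_ne_zero` (`Φ_C(u) ≠ 0`) and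
  `norm_deBruijnPhiC_div_head_sub_one_le` (`‖Φ_C(u)/a₁(u) − 1‖ ≤ 92e^{−3Y_c}`).

(At the far contour of the route, `x ≥ 9`, `|y| ≤ 0.09`: `e^{−3Y_c} < exp(−10¹⁶)`.) Mechanism = the real-axis tail argument of
Coffey–Csordas, Proposition 2.1 (`(n+2)² ≥ 4 + 4n`, `(n+2)⁴ ≤ 16·16ⁿ`) with `e^{4x}` replaced by `Re e^{4u} = e^{4x}cos 4y`.

## References

* E. C. Titchmarsh, *The Theory of the Riemann Zeta-Function*, 2nd ed. (1986), §10.1. [Titchmarsh1986]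
* M. W. Coffey, G. Csordas, *On the log-concavity of a Jacobi theta function*, Math. Comp. 82 (2013), Proposition 2.1. [CoffeyCsordas2013]
* N. G. de Bruijn, *The roots of trigonometric integrals*, Duke Math. J. 17 (1950). [deBruijn1950]
-/

noncomputable section

open Complex Real Set Filter Topology

namespace Literature.NumberTheory.LFunctions

/-! ## 1. The tail of the strip majorant -/

/-- `(n + 2)² ≤ 4·4ⁿ`. [folklore] -/
private theorem natCast_add_two_sq_le_four_pow (n : ℕ) : ((n : ℝ) + 2) ^ 2 ≤ 4 * 4 ^ n := by
  induction n with
  | zero => norm_num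
  | succ k ih =>
    push_cast
    have h4 : (4 : ℝ) ^ (k + 1) = 4 ^ k * 4 := pow_succ 4 k
    have hk : (0 : ℝ) ≤ k := k.cast_nonneg
    have h1 : ((k : ℝ) + 1 + 2) ^ 2 ≤ 4 * ((k : ℝ) + 2) ^ 2 := by nlinarith
    rw [h4]
    nlinarith [ih, h1]

/-- **Geometric domination of the `n ≥ 2` majorant terms**: with `Y_c = πe^{4x}cos 4y > 0`,
`majorant(x, y, n + 1) ≤ 16(2π²e^{9x} + 3πe^{5x})e^{−4Y_c}·(16e^{−4Y_c})ⁿ`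
(`(n+2)⁴ ≤ 16·16ⁿ`, `(n+2)² ≥ 4 + 4n`). [cite: CoffeyCsordas2013, Proposition 2.1 (proof)] -/
theorem deBruijnPhiStripMajorant_succ_le {x y : ℝ} (hc : 0 < Real.cos (4 * y)) (n : ℕ) :
    deBruijnPhiStripMajorant x y (n + 1) ≤
      16 * (2 * π ^ 2 * Real.exp (9 * x) + 3 * π * Real.exp (5 * x)) *
        Real.exp (-(4 * (π * Real.exp (4 * x) * Real.cos (4 * y)))) *
        (16 * Real.exp (-(4 * (π * Real.exp (4 * x) * Real.cos (4 * y))))) ^ n := by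
  set Yc := π * Real.exp (4 * x) * Real.cos (4 * y) with hYc
  have hYc0 : 0 < Yc := by rw [hYc]; have := Real.pi_pos; positivity
  have hsq : (((n + 1 : ℕ) : ℝ) + 1) ^ 2 = ((n : ℝ) + 2) ^ 2 := by push_cast; ring
  have h4 : (((n + 1 : ℕ) : ℝ) + 1) ^ 4 = (((n : ℝ) + 2) ^ 2) ^ 2 := by push_cast; ring
  have hn2 := natCast_add_two_sq_le_four_pow n
  have hn0 : (0 : ℝ) ≤ ((n : ℝ) + 2) ^ 2 := sq_nonneg _
  -- polynomial factor
  have hpoly : 2 * π ^ 2 * (((n + 1 : ℕ) : ℝ) + 1) ^ 4 * Real.exp (9 * x) +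
      3 * π * (((n + 1 : ℕ) : ℝ) + 1) ^ 2 * Real.exp (5 * x) ≤
      16 * 16 ^ n * (2 * π ^ 2 * Real.exp (9 * x) + 3 * π * Real.exp (5 * x)) := by
    rw [hsq, h4]
    have h16 : (((n : ℝ) + 2) ^ 2) ^ 2 ≤ 16 * 16 ^ n := by
      calc (((n : ℝ) + 2) ^ 2) ^ 2 ≤ (4 * 4 ^ n) ^ 2 := pow_le_pow_left₀ hn0 hn2 2
        _ = 16 * 16 ^ n := by rw [mul_pow, ← pow_mul, mul_comm n 2, pow_mul]; norm_num
    have h16' : ((n : ℝ) + 2) ^ 2 ≤ 16 * 16 ^ n := by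
      calc ((n : ℝ) + 2) ^ 2 ≤ 4 * 4 ^ n := hn2
        _ ≤ 16 * 16 ^ n := by
          have : (4 : ℝ) ^ n ≤ 16 ^ n := pow_le_pow_left₀ (by norm_num) (by norm_num) n
          nlinarith [pow_nonneg (by norm_num : (0:ℝ) ≤ 4) n]
    have hA : 0 ≤ 2 * π ^ 2 * Real.exp (9 * x) := by positivity
    have hB : 0 ≤ 3 * π * Real.exp (5 * x) := by positivity
    nlinarith [mul_le_mul_of_nonneg_left h16 hA, mul_le_mul_of_nonneg_left h16' hB]
  -- exponential factor: `π(n+2)²e^{4x}cos 4y ≥ (4 + 4n)·Y_c`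
  have hexp : Real.exp (-(π * (((n + 1 : ℕ) : ℝ) + 1) ^ 2 * Real.exp (4 * x) * Real.cos (4 * y))) ≤
      Real.exp (-(4 * Yc)) * Real.exp (-(4 * Yc)) ^ n := by
    rw [← Real.exp_nat_mul, ← Real.exp_add, hsq]
    apply Real.exp_le_exp.2
    have hn : (0 : ℝ) ≤ n := n.cast_nonneg
    have e : π * ((n : ℝ) + 2) ^ 2 * Real.exp (4 * x) * Real.cos (4 * y) = ((n : ℝ) + 2) ^ 2 * Yc := by
      rw [hYc]; ring
    rw [e]
    nlinarith [mul_nonneg (mul_nonneg hn hn) hYc0.le]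
  unfold deBruijnPhiStripMajorant
  have hP0 : 0 ≤ 16 * 16 ^ n * (2 * π ^ 2 * Real.exp (9 * x) + 3 * π * Real.exp (5 * x)) := by positivity
  calc _ ≤ (16 * 16 ^ n * (2 * π ^ 2 * Real.exp (9 * x) + 3 * π * Real.exp (5 * x))) *
        (Real.exp (-(4 * Yc)) * Real.exp (-(4 * Yc)) ^ n) :=
        mul_le_mul hpoly hexp (Real.exp_pos _).le hP0
    _ = _ := by rw [mul_pow]; ring

/-- **The majorant tail in closed form**: if `16e^{−4Y_c} ≤ 1/2` then
`∑_{n≥0} majorant(x, y, n + 1) ≤ 32(2π²e^{9x} + 3πe^{5x})e^{−4Y_c}`. [cite: CoffeyCsordas2013, Proposition 2.1 (proof)] -/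
theorem tsum_deBruijnPhiStripMajorant_succ_le {x y : ℝ} (hy : |y| < π / 8)
    (hq : 16 * Real.exp (-(4 * (π * Real.exp (4 * x) * Real.cos (4 * y)))) ≤ 1 / 2) :
    ∑' n, deBruijnPhiStripMajorant x y (n + 1) ≤
      32 * (2 * π ^ 2 * Real.exp (9 * x) + 3 * π * Real.exp (5 * x)) *
        Real.exp (-(4 * (π * Real.exp (4 * x) * Real.cos (4 * y)))) := by
  have hc := cos_four_mul_pos hy
  set q := 16 * Real.exp (-(4 * (π * Real.exp (4 * x) * Real.cos (4 * y)))) with hqdef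
  have hq0 : 0 ≤ q := by rw [hqdef]; positivity
  have hq1 : q < 1 := by linarith
  set C := 16 * (2 * π ^ 2 * Real.exp (9 * x) + 3 * π * Real.exp (5 * x)) *
    Real.exp (-(4 * (π * Real.exp (4 * x) * Real.cos (4 * y)))) with hCdef
  have hC0 : 0 ≤ C := by rw [hCdef]; positivity
  have hle : ∀ n, deBruijnPhiStripMajorant x y (n + 1) ≤ C * q ^ n := fun n =>
    deBruijnPhiStripMajorant_succ_le hc n
  have hg : Summable fun n : ℕ => C * q ^ n := (summable_geometric_of_lt_one hq0 hq1).mul_left C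
  have hs : Summable fun n => deBruijnPhiStripMajorant x y (n + 1) :=
    (summable_nat_add_iff 1).2 (summable_deBruijnPhiStripMajorant x hy)
  calc ∑' n, deBruijnPhiStripMajorant x y (n + 1) ≤ ∑' n, C * q ^ n := hs.tsum_le_tsum hle hg
    _ = C * (1 - q)⁻¹ := by rw [tsum_mul_left, tsum_geometric_of_lt_one hq0 hq1]
    _ ≤ C * 2 := by
        refine mul_le_mul_of_nonneg_left ?_ hC0
        rw [inv_le_comm₀ (by linarith) (by norm_num)]; linarith
    _ = _ := by rw [hCdef]; ring

/-! ## 2. Head dominance -/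

/-- **`Φ_C` minus its first term is bounded by the majorant tail**: for `|Im u| < π/8` and `16e^{−4Y_c} ≤ 1/2`,
`‖Φ_C(u) − a₁(u)‖ ≤ 32(2π²e^{9x} + 3πe^{5x})e^{−4Y_c}` (`a₁ = deBruijnPhiSummandC 0`, `x = Re u`, `y = Im u`,
`Y_c = πe^{4x}cos 4y`). [cite: Titchmarsh1986, §10.1] -/
theorem norm_deBruijnPhiC_sub_head_le (u : ℂ) (hu : |u.im| < π / 8)
    (hq : 16 * Real.exp (-(4 * (π * Real.exp (4 * u.re) * Real.cos (4 * u.im)))) ≤ 1 / 2) :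
    ‖deBruijnPhiC u - deBruijnPhiSummandC 0 u‖ ≤
      32 * (2 * π ^ 2 * Real.exp (9 * u.re) + 3 * π * Real.exp (5 * u.re)) *
        Real.exp (-(4 * (π * Real.exp (4 * u.re) * Real.cos (4 * u.im)))) := by
  have hs := summable_deBruijnPhiSummandC hu
  have hsn := summable_norm_deBruijnPhiSummandC hu
  have e : deBruijnPhiC u - deBruijnPhiSummandC 0 u = ∑' n, deBruijnPhiSummandC (n + 1) u := by
    unfold deBruijnPhiC; rw [hs.tsum_eq_zero_add]; ring
  rw [e]
  have hs1 : Summable fun n => ‖deBruijnPhiSummandC (n + 1) u‖ := (summable_nat_add_iff 1).2 hsn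
  have hm1 : Summable fun n => deBruijnPhiStripMajorant u.re u.im (n + 1) :=
    (summable_nat_add_iff 1).2 (summable_deBruijnPhiStripMajorant u.re hu)
  calc ‖∑' n, deBruijnPhiSummandC (n + 1) u‖ ≤ ∑' n, ‖deBruijnPhiSummandC (n + 1) u‖ := norm_tsum_le_tsum_norm hs1
    _ ≤ ∑' n, deBruijnPhiStripMajorant u.re u.im (n + 1) :=
        hs1.tsum_le_tsum (fun n => norm_deBruijnPhiSummandC_le (n + 1) u) hm1
    _ ≤ _ := tsum_deBruijnPhiStripMajorant_succ_le hu hq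

/-- **The first term from below**: `‖a₁(u)‖ ≥ (2π²e^{9x} − 3πe^{5x})·e^{−Y_c}` (reverse triangle inequality and
`‖exp(−πe^{4u})‖ = e^{−Y_c}`). [cite: Titchmarsh1986, §10.1] -/
theorem le_norm_deBruijnPhiSummandC_zero (u : ℂ) :
    (2 * π ^ 2 * Real.exp (9 * u.re) - 3 * π * Real.exp (5 * u.re)) *
        Real.exp (-(π * Real.exp (4 * u.re) * Real.cos (4 * u.im))) ≤ ‖deBruijnPhiSummandC 0 u‖ := by
  have hA : 0 ≤ 2 * π ^ 2 * (((0 : ℕ) : ℝ) + 1) ^ 4 := by positivity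
  have hB : 0 ≤ 3 * π * (((0 : ℕ) : ℝ) + 1) ^ 2 := by positivity
  have h9 : ‖((2 * π ^ 2 * (((0 : ℕ) : ℝ) + 1) ^ 4 : ℝ) : ℂ) * Complex.exp (9 * u)‖ = 2 * π ^ 2 * Real.exp (9 * u.re) := by
    rw [norm_mul, Complex.norm_real, Real.norm_of_nonneg hA, norm_cexp_ofNat_mul]; simp
  have h5 : ‖((3 * π * (((0 : ℕ) : ℝ) + 1) ^ 2 : ℝ) : ℂ) * Complex.exp (5 * u)‖ = 3 * π * Real.exp (5 * u.re) := by
    rw [norm_mul, Complex.norm_real, Real.norm_of_nonneg hB, norm_cexp_ofNat_mul]; simp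
  have hG : ‖Complex.exp (-(((π * (((0 : ℕ) : ℝ) + 1) ^ 2 : ℝ) : ℂ) * Complex.exp (4 * u)))‖ =
      Real.exp (-(π * Real.exp (4 * u.re) * Real.cos (4 * u.im))) := by
    rw [norm_cexp_deBruijnGaussFactor]; simp
  unfold deBruijnPhiSummandC
  rw [norm_mul, hG]
  refine mul_le_mul_of_nonneg_right ?_ (Real.exp_pos _).le
  have h := norm_sub_norm_le (((2 * π ^ 2 * (((0 : ℕ) : ℝ) + 1) ^ 4 : ℝ) : ℂ) * Complex.exp (9 * u))
    (((3 * π * (((0 : ℕ) : ℝ) + 1) ^ 2 : ℝ) : ℂ) * Complex.exp (5 * u))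
  rw [h9, h5] at h
  exact h

/-- `16e^{−8} ≤ 1/2` and `92e^{−6} < 1`, the numerics behind the threshold `Y_c ≥ 2`. [folklore] -/
private theorem exp_thresholds : 16 * Real.exp (-8) ≤ 1 / 2 ∧ 92 * Real.exp (-6) < 1 := by
  have h1 : (2.7182818283 : ℝ) < Real.exp 1 := Real.exp_one_gt_d9
  have h0 : (0 : ℝ) ≤ 2.7182818283 := by norm_num
  have h6 : (92 : ℝ) < Real.exp 6 := by
    have : Real.exp 6 = Real.exp 1 ^ 6 := by rw [← Real.exp_nat_mul]; norm_num
    rw [this]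
    exact lt_trans (by norm_num) (pow_lt_pow_left₀ h1 h0 (by norm_num : (6:ℕ) ≠ 0))
  have h8 : (256 : ℝ) < Real.exp 8 := by
    have : Real.exp 8 = Real.exp 1 ^ 8 := by rw [← Real.exp_nat_mul]; norm_num
    rw [this]
    exact lt_trans (by norm_num) (pow_lt_pow_left₀ h1 h0 (by norm_num : (8:ℕ) ≠ 0))
  have e6 : Real.exp (-6) = (Real.exp 6)⁻¹ := Real.exp_neg 6
  have e8 : Real.exp (-8) = (Real.exp 8)⁻¹ := Real.exp_neg 8
  constructor
  · rw [e8]; rw [show (16 : ℝ) * (Real.exp 8)⁻¹ = 16 / Real.exp 8 by ring, div_le_iff₀ (by positivity)]; linarith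
  · rw [e6]; rw [show (92 : ℝ) * (Real.exp 6)⁻¹ = 92 / Real.exp 6 by ring, div_lt_iff₀ (by positivity)]; linarith

/-- **Head dominance, relative form**: for `Re u ≥ 0`, `|Im u| < π/8` and `Y_c = πe^{4Re u}cos(4 Im u) ≥ 2`,
`‖Φ_C(u) − a₁(u)‖ ≤ 92e^{−3Y_c}·‖a₁(u)‖` (`32·(2π²e^{4x} + 3π)/(2π²e^{4x} − 3π) ≤ 92` for `x ≥ 0`).
[cite: Titchmarsh1986, §10.1] -/
theorem norm_deBruijnPhiC_sub_head_le_mul_norm_head (u : ℂ) (hu : |u.im| < π / 8) (hx : 0 ≤ u.re)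
    (hY : 2 ≤ π * Real.exp (4 * u.re) * Real.cos (4 * u.im)) :
    ‖deBruijnPhiC u - deBruijnPhiSummandC 0 u‖ ≤
      92 * Real.exp (-(3 * (π * Real.exp (4 * u.re) * Real.cos (4 * u.im)))) * ‖deBruijnPhiSummandC 0 u‖ := by
  set Yc := π * Real.exp (4 * u.re) * Real.cos (4 * u.im) with hYc
  have hπ := Real.pi_gt_d2
  have hπ' := Real.pi_lt_d2
  -- the threshold
  have hq : 16 * Real.exp (-(4 * Yc)) ≤ 1 / 2 := by
    have : Real.exp (-(4 * Yc)) ≤ Real.exp (-8) := Real.exp_le_exp.2 (by linarith)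
    linarith [exp_thresholds.1]
  have htail := norm_deBruijnPhiC_sub_head_le u hu hq
  have hhead := le_norm_deBruijnPhiSummandC_zero u
  -- sizes: `E = e^{4x} ≥ 1`, `e^{9x} = e^{5x}·E`
  set E := Real.exp (4 * u.re) with hE
  have hE1 : 1 ≤ E := Real.one_le_exp (by linarith)
  have h5 : 0 < Real.exp (5 * u.re) := Real.exp_pos _
  have h9 : Real.exp (9 * u.re) = Real.exp (5 * u.re) * E := by rw [hE, ← Real.exp_add]; ring_nf
  -- `32(2π²E + 3π) ≤ 92(2π²E − 3π)` for `E ≥ 1`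
  have hkey : 32 * (2 * π ^ 2 * E + 3 * π) ≤ 92 * (2 * π ^ 2 * E - 3 * π) := by nlinarith
  have hlow : 0 < 2 * π ^ 2 * E - 3 * π := by nlinarith
  -- `e^{−4Y_c} = e^{−3Y_c}·e^{−Y_c}`
  have hsplit : Real.exp (-(4 * Yc)) = Real.exp (-(3 * Yc)) * Real.exp (-Yc) := by
    rw [← Real.exp_add]; ring_nf
  have h3 : 0 < Real.exp (-(3 * Yc)) := Real.exp_pos _
  have h1 : 0 < Real.exp (-Yc) := Real.exp_pos _
  calc ‖deBruijnPhiC u - deBruijnPhiSummandC 0 u‖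
      ≤ 32 * (2 * π ^ 2 * Real.exp (9 * u.re) + 3 * π * Real.exp (5 * u.re)) * Real.exp (-(4 * Yc)) := htail
    _ = 32 * (2 * π ^ 2 * E + 3 * π) * Real.exp (5 * u.re) * (Real.exp (-(3 * Yc)) * Real.exp (-Yc)) := by
        rw [h9, hsplit]; ring
    _ ≤ 92 * (2 * π ^ 2 * E - 3 * π) * Real.exp (5 * u.re) * (Real.exp (-(3 * Yc)) * Real.exp (-Yc)) := by
        gcongr
    _ = 92 * Real.exp (-(3 * Yc)) *
        ((2 * π ^ 2 * Real.exp (9 * u.re) - 3 * π * Real.exp (5 * u.re)) * Real.exp (-Yc)) := by rw [h9]; ring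
    _ ≤ 92 * Real.exp (-(3 * Yc)) * ‖deBruijnPhiSummandC 0 u‖ :=
        mul_le_mul_of_nonneg_left hhead (by positivity)

/-- **`Φ_C` does not vanish near the real axis**: for `Re u ≥ 0`, `|Im u| < π/8`, `πe^{4Re u}cos(4Im u) ≥ 2`,
`Φ_C(u) ≠ 0` (the first term beats all others by the factor `92e^{−3Y_c} ≤ 92e^{−6} < 1`). [cite: deBruijn1950, §1] -/
theorem deBruijnPhiC_ne_zero (u : ℂ) (hu : |u.im| < π / 8) (hx : 0 ≤ u.re)
    (hY : 2 ≤ π * Real.exp (4 * u.re) * Real.cos (4 * u.im)) : deBruijnPhiC u ≠ 0 := by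
  have h := norm_deBruijnPhiC_sub_head_le_mul_norm_head u hu hx hY
  have hhead := le_norm_deBruijnPhiSummandC_zero u
  have hπ := Real.pi_gt_d2
  have hE1 : 1 ≤ Real.exp (4 * u.re) := Real.one_le_exp (by linarith)
  have h9 : Real.exp (9 * u.re) = Real.exp (5 * u.re) * Real.exp (4 * u.re) := by rw [← Real.exp_add]; ring_nf
  have hpos : 0 < ‖deBruijnPhiSummandC 0 u‖ := by
    refine lt_of_lt_of_le ?_ hhead
    have hππ : 0 < π * (2 * π - 3) := mul_pos Real.pi_pos (by linarith)
    have hE' : 2 * π ^ 2 * 1 ≤ 2 * π ^ 2 * Real.exp (4 * u.re) := mul_le_mul_of_nonneg_left hE1 (by positivity)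
    have hlow : 0 < 2 * π ^ 2 * Real.exp (4 * u.re) - 3 * π := by linarith
    have e : 2 * π ^ 2 * Real.exp (9 * u.re) - 3 * π * Real.exp (5 * u.re) =
        Real.exp (5 * u.re) * (2 * π ^ 2 * Real.exp (4 * u.re) - 3 * π) := by rw [h9]; ring
    rw [e]
    exact mul_pos (mul_pos (Real.exp_pos _) hlow) (Real.exp_pos _)
  have hsmall : 92 * Real.exp (-(3 * (π * Real.exp (4 * u.re) * Real.cos (4 * u.im)))) < 1 := by
    have : Real.exp (-(3 * (π * Real.exp (4 * u.re) * Real.cos (4 * u.im)))) ≤ Real.exp (-6) :=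
      Real.exp_le_exp.2 (by linarith)
    linarith [exp_thresholds.2]
  intro h0
  rw [h0, zero_sub, norm_neg] at h
  nlinarith

/-- **Head dominance as a ratio**: under the same hypotheses `‖Φ_C(u)/a₁(u) − 1‖ ≤ 92e^{−3Y_c}`.
[cite: Titchmarsh1986, §10.1] -/
theorem norm_deBruijnPhiC_div_head_sub_one_le (u : ℂ) (hu : |u.im| < π / 8) (hx : 0 ≤ u.re)
    (hY : 2 ≤ π * Real.exp (4 * u.re) * Real.cos (4 * u.im)) :
    ‖deBruijnPhiC u / deBruijnPhiSummandC 0 u - 1‖ ≤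
      92 * Real.exp (-(3 * (π * Real.exp (4 * u.re) * Real.cos (4 * u.im)))) := by
  have h := norm_deBruijnPhiC_sub_head_le_mul_norm_head u hu hx hY
  have hhead := le_norm_deBruijnPhiSummandC_zero u
  have hπ := Real.pi_gt_d2
  have hE1 : 1 ≤ Real.exp (4 * u.re) := Real.one_le_exp (by linarith)
  have h9 : Real.exp (9 * u.re) = Real.exp (5 * u.re) * Real.exp (4 * u.re) := by rw [← Real.exp_add]; ring_nf
  have hpos : 0 < ‖deBruijnPhiSummandC 0 u‖ := by
    refine lt_of_lt_of_le ?_ hhead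
    have hππ : 0 < π * (2 * π - 3) := mul_pos Real.pi_pos (by linarith)
    have hE' : 2 * π ^ 2 * 1 ≤ 2 * π ^ 2 * Real.exp (4 * u.re) := mul_le_mul_of_nonneg_left hE1 (by positivity)
    have hlow : 0 < 2 * π ^ 2 * Real.exp (4 * u.re) - 3 * π := by linarith
    have e : 2 * π ^ 2 * Real.exp (9 * u.re) - 3 * π * Real.exp (5 * u.re) =
        Real.exp (5 * u.re) * (2 * π ^ 2 * Real.exp (4 * u.re) - 3 * π) := by rw [h9]; ring
    rw [e]
    exact mul_pos (mul_pos (Real.exp_pos _) hlow) (Real.exp_pos _)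
  have hne : deBruijnPhiSummandC 0 u ≠ 0 := norm_pos_iff.1 hpos
  have e : deBruijnPhiC u / deBruijnPhiSummandC 0 u - 1 =
      (deBruijnPhiC u - deBruijnPhiSummandC 0 u) / deBruijnPhiSummandC 0 u := by
    field_simp
  rw [e, norm_div, div_le_iff₀ hpos]
  exact h

end Literature.NumberTheory.LFunctions

end
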